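import Literature.Topology.FourManifolds.TautFoliationsFenceHeightGerm
import Literature.Topology.FourManifolds.TautFoliationsCollarDisc
import HarnessLib

/-!
# Heights of a closed fence read through the angle: local homeomorphism germs of the level

Sibling of `TautFoliationsFenceHeightGerm.lean` and `TautFoliationsCollarDisc.lean`. A fence
`Φ` over the unit interval with closed levels (`Φ 1 τ = Φ 0 τ`) descends to a continuous map
`Ψ` on `Real.Angle × (levels)` (`SquarePolar.descend` of `(t, τ) ↦ Φ (loopParam t) τ`). Near
every point `(α₀, τ₁)`, the height of `Ψ` in a flow box containing `Ψ (α₀, τ₁)` is `χ(τ)` for a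
homeomorphism germ `χ` of the level, independent of the angle — also across the cut angle `0`,
where the two ends of the fence meet (their height germs agree because `Φ 1 τ = Φ 0 τ`). Hence
along any continuous curve avoiding the centre, the heights of the collar disc are locally
homeomorphism germs of the level function.

* `IsFenceOn.fenceFamily`, `IsFenceOn.descendFence` (**definitions**);
* `IsFenceOn.descendFence_coe`, `IsFenceOn.apply_angleParam_eq_descendFence` (**proved**);
* `IsFenceOn.exists_height_germ_descend` (**proved**): the main statement.

All statements are [folklore].
-/

noncomputable section

open Set Filter Function Real
open scoped Topology unitInterval

namespace Literature.Topology.FourManifolds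

namespace Foliation

open SquarePolar

variable {B : Type*} [NormedAddCommGroup B] {M : Type*} [TopologicalSpace M] {F : Foliation B M}
variable {Γ : C(I, F.GermSpace)} {τ₀ ε : ℝ} {Φ : I → ℝ → M}

namespace IsFenceOn

/-- The fence as a `2π`-periodic family in the loop variable. [folklore] -/
def fenceFamily (Φ : I → ℝ → M) : ℝ → ℝ → M := fun t τ ↦ Φ (loopParam t) τ

/-- **The fence descended to `Real.Angle × ℝ`.** [folklore] -/
def descendFence (Φ : I → ℝ → M) : Real.Angle × ℝ → M := descend (fenceFamily Φ)

omit [TopologicalSpace M] in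
/-- Value of the descended fence on representatives. [folklore] -/
theorem descendFence_coe {t : ℝ} (ht : t ∈ Ico 0 (2 * π)) (τ : ℝ) :
    descendFence Φ ((t : Real.Angle), τ) = Φ (loopParam t) τ :=
  descend_coe _ ht τ

omit [TopologicalSpace M] in
/-- The collar-disc formula through the descended fence: `Φ (angleParam c₀ x) τ = Ψ (ang c₀ x, τ)`.
[folklore] -/
theorem apply_angleParam_eq_descendFence (c₀ x : ℝ × ℝ) (τ : ℝ) :
    Φ (angleParam c₀ x) τ = descendFence Φ (ang c₀ x, τ) := by
  conv_rhs => rw [← coe_rep_ang c₀ x]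
  rw [descendFence_coe (rep_ang_mem c₀ x)]
  rfl

/-- **Near every point, the height of the descended closed fence in a flow box is a homeomorphism
germ of the level, independent of the angle.** [folklore] -/
theorem exists_height_germ_descend (hΦ : IsFenceOn F Γ τ₀ ε Φ univ)
    (hcl : ∀ τ ∈ Ioo (τ₀ - ε) (τ₀ + ε), Φ 1 τ = Φ 0 τ)
    {e : OpenPartialHomeomorph M (B × ℝ)} (he : e ∈ F.atlas) {α₀ : Real.Angle} {τ₁ : ℝ}
    (hτ₁ : τ₁ ∈ Ioo (τ₀ - ε) (τ₀ + ε)) (hsrc : descendFence Φ (α₀, τ₁) ∈ e.source) :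
    ∃ χ : ℝ → ℝ, IsHomeoGermAt χ τ₁ ∧ ∀ᶠ q : Real.Angle × ℝ in 𝓝 (α₀, τ₁), height e (descendFence Φ q) = χ q.2 := by
  -- the representative of the angle
  set t₀ : ℝ := (AddCircle.equivIco (2 * π) 0 α₀ : ℝ) with ht₀
  have ht₀mem : t₀ ∈ Ico 0 (2 * π) := by
    have h := (AddCircle.equivIco (2 * π) 0 α₀).2
    exact ⟨h.1, by have := h.2; linarith⟩
  have hα₀ : (t₀ : Real.Angle) = α₀ := AddCircle.coe_equivIco
  have hopen : IsOpenMap (fun t : ℝ ↦ ((t : ℝ) : Real.Angle)) := QuotientAddGroup.isOpenMap_coe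
  -- the point in terms of the fence
  have hpt : descendFence Φ (α₀, τ₁) = Φ (loopParam t₀) τ₁ := by rw [← hα₀, descendFence_coe ht₀mem]
  rw [hpt] at hsrc
  obtain ⟨χ, hχ, hχev⟩ := hΦ.exists_height_germ he hτ₁ hsrc
  refine ⟨χ, hχ, ?_⟩
  obtain ⟨V, hV, W, hW, hVW⟩ := mem_nhds_prod_iff.1 hχev
  by_cases ht₀pos : 0 < t₀
  · -- away from the cut: angles near `α₀` are `↑t` with `t` near `t₀` inside `(0, 2π)`
    have hpre : loopParam ⁻¹' V ∈ 𝓝 t₀ := continuous_loopParam.continuousAt.preimage_mem_nhds hV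
    obtain ⟨δ, hδ, hδsub⟩ := Metric.mem_nhds_iff.1 (inter_mem hpre (Ioo_mem_nhds ht₀pos ht₀mem.2))
    have hN : (fun t : ℝ ↦ ((t : ℝ) : Real.Angle)) '' Metric.ball t₀ δ ∈ 𝓝 α₀ := by
      rw [← hα₀]
      exact hopen.image_mem_nhds (Metric.ball_mem_nhds t₀ hδ)
    have hprod : ((fun t : ℝ ↦ ((t : ℝ) : Real.Angle)) '' Metric.ball t₀ δ) ×ˢ W ∈ 𝓝 (α₀, τ₁) := prod_mem_nhds hN hW
    filter_upwards [hprod] with q hq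
    obtain ⟨⟨t, ht, hqt⟩, hqW⟩ := hq
    obtain ⟨htV, htI⟩ := hδsub ht
    have hq1 : q = ((t : Real.Angle), q.2) := Prod.ext hqt.symm rfl
    rw [hq1, descendFence_coe ⟨htI.1.le, htI.2⟩]
    exact hVW (mk_mem_prod htV hqW)
  · -- at the cut: `t₀ = 0`, the two ends of the fence
    have ht₀0 : t₀ = 0 := le_antisymm (not_lt.1 ht₀pos) ht₀mem.1
    have hl0 : loopParam t₀ = 0 := by rw [ht₀0, loopParam_zero]
    rw [hl0] at hsrc hV
    -- the germ at the other end `1`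
    have hsrc1 : Φ 1 τ₁ ∈ e.source := by rw [hcl τ₁ hτ₁]; exact hsrc
    obtain ⟨χ', -, hχ'ev⟩ := hΦ.exists_height_germ he hτ₁ hsrc1
    obtain ⟨V', hV', W', hW', hVW'⟩ := mem_nhds_prod_iff.1 hχ'ev
    -- a common level neighbourhood inside the admissible levels
    set W₀ := W ∩ W' ∩ Ioo (τ₀ - ε) (τ₀ + ε) with hW₀
    have hW₀ : W₀ ∈ 𝓝 τ₁ := inter_mem (inter_mem hW hW') (isOpen_Ioo.mem_nhds hτ₁)
    -- the two germs agree on `W₀`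
    have hagree : ∀ τ ∈ W₀, χ' τ = χ τ := fun τ hτ ↦ by
      have h0 := hVW (mk_mem_prod (mem_of_mem_nhds hV) hτ.1.1)
      have h1 := hVW' (mk_mem_prod (mem_of_mem_nhds hV') hτ.1.2)
      simp only at h0 h1
      rw [← h1, ← h0, hcl τ hτ.2]
    -- real parameters near `0` on both sides
    have hpre0 : loopParam ⁻¹' V ∈ 𝓝 (0 : ℝ) := by
      have h : ContinuousAt loopParam (0 : ℝ) := continuous_loopParam.continuousAt
      have hV0 : V ∈ 𝓝 (loopParam 0) := by rwa [loopParam_zero]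
      exact h.preimage_mem_nhds hV0
    have hpre1 : (fun t ↦ loopParam (t + 2 * π)) ⁻¹' V' ∈ 𝓝 (0 : ℝ) := by
      have h : ContinuousAt (fun t : ℝ ↦ loopParam (t + 2 * π)) 0 :=
        (continuous_loopParam.comp (continuous_id.add (continuous_const (y := 2 * π)))).continuousAt
      have hV1 : V' ∈ 𝓝 (loopParam ((0 : ℝ) + 2 * π)) := by rwa [zero_add, loopParam_two_pi]
      exact h.preimage_mem_nhds hV1
    obtain ⟨δ, hδ, hδsub⟩ := Metric.mem_nhds_iff.1 (inter_mem (inter_mem hpre0 hpre1) (Ioo_mem_nhds (by linarith [Real.two_pi_pos] : -(2 * π) < 0) Real.two_pi_pos))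
    have hN : (fun t : ℝ ↦ ((t : ℝ) : Real.Angle)) '' Metric.ball 0 δ ∈ 𝓝 α₀ := by
      rw [← hα₀, ht₀0]
      exact hopen.image_mem_nhds (Metric.ball_mem_nhds 0 hδ)
    have hprod : ((fun t : ℝ ↦ ((t : ℝ) : Real.Angle)) '' Metric.ball 0 δ) ×ˢ W₀ ∈ 𝓝 (α₀, τ₁) := prod_mem_nhds hN hW₀
    filter_upwards [hprod] with q hq
    obtain ⟨⟨t, ht, hqt⟩, hqW⟩ := hq
    obtain ⟨⟨htV, htV'⟩, htI⟩ := hδsub ht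
    rcases le_or_gt 0 t with ht0 | ht0
    · -- `t ≥ 0`: the end `0`
      have hq1 : q = ((t : Real.Angle), q.2) := Prod.ext hqt.symm rfl
      rw [hq1, descendFence_coe ⟨ht0, htI.2⟩]
      exact hVW (mk_mem_prod htV hqW.1.1)
    · -- `t < 0`: the end `1`, through `t + 2π`
      have hcoe : ((t : ℝ) : Real.Angle) = (((t + 2 * π : ℝ)) : Real.Angle) := (AddCircle.coe_add_period (2 * π) t).symm
      have hq1 : q = (((t + 2 * π : ℝ) : Real.Angle), q.2) := Prod.ext (by rw [← hcoe]; exact hqt.symm) rfl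
      rw [hq1, descendFence_coe ⟨by linarith [htI.1], by linarith⟩, ← hagree q.2 hqW]
      exact hVW' (mk_mem_prod htV' hqW.1.2)

end IsFenceOn

end Foliation

end Literature.Topology.FourManifolds
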